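import Literature.Analysis.FluidPDE.IntermittentJetBounds
import HarnessLib

/-!
# Intermittent jets on `𝕋³`: second space derivatives of the pipe profile (BV §7.4 (7.23))

Analysis/FluidPDE support file (everything proved), addendum to `IntermittentJetBounds`:
the sup bound `|∂ᵢ∂ₗ ψ̃_x| ≤ C σ² μ³` of the second space derivatives of the rescaled pipe
profile `ψ̃_x(y) = ψ_x(σ•(y - s_x))` (Buckmaster–Vicol, EMS Surv. Math. Sci. 6 (2019), §7.4
(7.23) with `N = 2`, `p = ∞`: `‖∇²ψ‖_{L^∞} ≲ r_⊥^{-1} λ²` with `r_⊥ = μ⁻¹`, `λ = σμ`), needed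
for the crude `C¹` bound (2.3) of the corrector `∇ζ` in the jet-based Navier–Stokes step.

## References

* T. Buckmaster, V. Vicol, EMS Surv. Math. Sci. 6 (2019) = arXiv:1901.09023, §7.4 (7.23). [`BuckmasterVicol2020`]
* A. Cheskidov, X. Luo, Invent. Math. 229 (2022) = arXiv:2009.06596, Thm. 4.3 (2). [`CheskidovLuo2022`]
-/

noncomputable section

open MeasureTheory Set Function UnitAddTorus
open scoped ContDiff ENNReal NNReal

namespace Literature.Analysis.FluidPDE

/-! ## `∂ᵢ∂ₗψ_x` is concentrated of order `(d-1)/2 + 2` -/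

namespace Mikado

open FunctionSpaces NashGeometric Transverse Finset

variable {d : Type*} [Fintype d] [DecidableEq d] (x : Index d)

/-- **`∂ᵢ∂ₗψ_x` is concentrated of order `(d-1)/2 + 2`** (CL22 Thm. 4.3 (2), `m = 2`). [cite: CheskidovLuo2022, Thm. 4.3 (2)] -/
theorem isConc_partialDeriv_partialDeriv_psi (i l : d) :
    IsConc d (((Fintype.card d : ℝ) - 1) / 2 + 2) (fun μ => Torus.partialDeriv i (Torus.partialDeriv l (psi x μ))) := by
  have h : IsConc d (((Fintype.card d : ℝ) - 1) / 2 + 2) (fun μ y => ∑ l', ((datum x).A l l' : ℝ) *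
      ∑ l'', ((datum x).A i l'' : ℝ) * (datum x).pull (conc (normConst (datum x).c)
        ((Fintype.card (Slot x) : ℝ) / 2 + 1 + 1) μ (pd l'' (pd l' (psi0 (datum x).c)))) y) := by
    refine IsConc.sum _ fun l' _ => IsConc.const_mul (IsConc.sum _ fun l'' _ => IsConc.const_mul ?_ _) _
    exact (isConc_pull_conc x (((isProfile_psi0 (datum x).c).pd l').pd l'') (normConst (datum x).c)
      ((Fintype.card (Slot x) : ℝ) / 2 + 1 + 1)).of_eq (by rw [card_slot_real]; ring)
  refine h.congr fun μ hμ => ?_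
  exact (partialDeriv_partialDeriv_pull_conc (datum x) (isProfile_psi0 _) hμ _ _ i l).symm

/-- `∂ᵢ∂ₗ psiR (y) = σ² (∂ᵢ∂ₗψ_x)(σ•y)`. [folklore] -/
theorem partialDeriv_partialDeriv_psiR {μ : ℝ} (hμ : 1 ≤ μ) (σ : ℕ) (i l : d) (y : UnitAddTorus d) :
    Torus.partialDeriv i (Torus.partialDeriv l (psiR x μ σ)) y =
      (σ : ℝ) ^ 2 * Torus.partialDeriv i (Torus.partialDeriv l (psi x μ)) (σ • y) := by
  have e : Torus.partialDeriv l (psiR x μ σ) = fun z => (σ : ℝ) * Torus.partialDeriv l (psi x μ) (σ • z) :=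
    funext (partialDeriv_psiR x μ σ l)
  have h1 : Torus.IsContDiff 1 (fun z => Torus.partialDeriv l (psi x μ) (σ • z)) :=
    (isSmooth_comp_nsmul ((isSmooth_psi x hμ).partialDeriv l) σ).isContDiff (by simp)
  rw [e, Torus.partialDeriv_const_mul_apply h1, partialDeriv_comp_nsmul, smul_eq_mul]
  ring

end Mikado

namespace Jet

open FunctionSpaces FunctionSpaces.Torus Mikado NashGeometric Transverse

local notation "𝔡" => Fin 3

/-- **A uniform constant for `∂ᵢ∂ₗψ_x` on `𝕋³`**: `|∂ᵢ∂ₗψ_x| ≤ C μ³` for all directions and `μ ≥ 1`.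
[cite: BuckmasterVicol2020, §7.4 (7.23)] -/
theorem exists_ddpsi_const : ∃ C : ℝ, 1 ≤ C ∧ ∀ (x : Index 𝔡) (μ : ℝ), 1 ≤ μ →
    ∀ i l y, |Torus.partialDeriv i (Torus.partialDeriv l (psi x μ)) y| ≤ C * μ ^ 3 := by
  have hcard : ((Fintype.card 𝔡 : ℝ) - 1) / 2 + 2 = 3 := by norm_num [Fintype.card_fin]
  choose C hC0 hS using fun (x : Index 𝔡) i l => (isConc_partialDeriv_partialDeriv_psi x i l).exists_sup
  refine ⟨1 + ∑ x, ∑ i, ∑ l, C x i l, by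
    have : 0 ≤ ∑ x, ∑ i, ∑ l, C x i l := Finset.sum_nonneg fun x _ => Finset.sum_nonneg fun i _ => Finset.sum_nonneg fun l _ => hC0 x i l
    linarith, fun x μ hμ i l y => ?_⟩
  have h1 := hS x i l μ hμ y
  rw [hcard, show (3 : ℝ) = ((3 : ℕ) : ℝ) by norm_num, Real.rpow_natCast] at h1
  have hle : C x i l ≤ 1 + ∑ x, ∑ i, ∑ l, C x i l := by
    have s1 : C x i l ≤ ∑ l', C x i l' := Finset.single_le_sum (f := fun l' => C x i l') (fun l' _ => hC0 x i l') (Finset.mem_univ l)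
    have s2 : ∑ l', C x i l' ≤ ∑ i', ∑ l', C x i' l' :=
      Finset.single_le_sum (f := fun i' => ∑ l', C x i' l') (fun i' _ => Finset.sum_nonneg fun l' _ => hC0 x i' l') (Finset.mem_univ i)
    have s3 : ∑ i', ∑ l', C x i' l' ≤ ∑ x', ∑ i', ∑ l', C x' i' l' :=
      Finset.single_le_sum (f := fun x' => ∑ i', ∑ l', C x' i' l')
        (fun x' _ => Finset.sum_nonneg fun i' _ => Finset.sum_nonneg fun l' _ => hC0 x' i' l') (Finset.mem_univ x)
    linarith
  have hμ0 : 0 ≤ μ ^ 3 := by positivity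
  exact h1.trans (mul_le_mul_of_nonneg_right hle hμ0)

variable {J : Params} (s : Index 𝔡 → UnitAddTorus 𝔡) (h : J.Valid)
include h

/-- `∂ᵢ∂ₗψ̃_x(y) = σ² (∂ᵢ∂ₗψ_x)(σ•y - σ•s_x)`. [folklore] -/
theorem partialDeriv_partialDeriv_psiJ_eq (x : Index 𝔡) (i l : 𝔡) (y : UnitAddTorus 𝔡) :
    Torus.partialDeriv i (Torus.partialDeriv l (psiJ J s x)) y =
      (J.σ : ℝ) ^ 2 * Torus.partialDeriv i (Torus.partialDeriv l (psi x J.μ)) (J.σ • y - J.σ • s x) := by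
  have e : Torus.partialDeriv l (psiJ J s x) = fun y => Torus.partialDeriv l (psiR x J.μ J.σ) (y - s x) := by
    funext z
    show Torus.partialDeriv l (fun y => psiR x J.μ J.σ (y - s x)) z = _
    rw [partialDeriv_comp_sub]
  rw [e, partialDeriv_comp_sub]
  simp only
  rw [partialDeriv_partialDeriv_psiR x h.hμ, smul_sub]

/-- **`|∂ᵢ∂ₗψ̃_x| ≤ C σ² μ³`** with the uniform constant of `exists_ddpsi_const`. [cite: BuckmasterVicol2020, §7.4 (7.23)] -/
theorem abs_partialDeriv_partialDeriv_psiJ_le {C : ℝ}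
    (hC : ∀ (x : Index 𝔡) (μ : ℝ), 1 ≤ μ → ∀ i l y, |Torus.partialDeriv i (Torus.partialDeriv l (psi x μ)) y| ≤ C * μ ^ 3)
    (x : Index 𝔡) (i l : 𝔡) (y : UnitAddTorus 𝔡) :
    |Torus.partialDeriv i (Torus.partialDeriv l (psiJ J s x)) y| ≤ C * (J.σ : ℝ) ^ 2 * J.μ ^ 3 := by
  rw [partialDeriv_partialDeriv_psiJ_eq s h x i l y, abs_mul, abs_of_nonneg (sq_nonneg _)]
  calc (J.σ : ℝ) ^ 2 * |Torus.partialDeriv i (Torus.partialDeriv l (psi x J.μ)) (J.σ • y - J.σ • s x)| ≤ (J.σ : ℝ) ^ 2 * (C * J.μ ^ 3) :=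
        mul_le_mul_of_nonneg_left (hC x J.μ h.hμ i l _) (sq_nonneg _)
    _ = _ := by ring

end Jet

end Literature.Analysis.FluidPDE
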